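import Summits.ResolutionOfSingularities.ResolutionOfSingularities.Theorems.PurelyInseparableDim4IsoSpineFrame
import HarnessLib
import HarnessLib.Audit.Tags

/-!
# Purely inseparable four-folds — ISO-SPINE-PO, part IV: F4-I REDUCES TO THE TRANSLATED EDGES
# [OURS · counted 0 · cell res-dim4-pi · frame v4 TIER 1 (I)]

Sequel of `PurelyInseparableDim4IsoSpineFrame.lean` (`IsoSpine.no_isolated_origin_branch`: no infinite
chart-ORIGIN branch of isolated `q`-fold states, every `q`, every field).  Consequence for the frame
question F4-I `PIDim4.NoIsolatedTrap p q` (Scope add-on: no infinite `Step0`-branch of ISOLATED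
states): it now hinges on the TRANSLATED edges only.  Precisely (`noIsolatedTrap_of_rank`): if over
every field of characteristic `p` there is an `ℕ`-valued function `Φ` on presented states which, along
`Step0` edges between isolated states, NEVER INCREASES and STRICTLY DECREASES whenever the edge is not a
chart-origin edge, then `NoIsolatedTrap p q` holds — because `Φ` is eventually constant along any
infinite branch, whose tail is then an all-origin isolated branch, which part III forbids.  The census
candidates for `Φ` are card I-3-2's jet colength `μ⁺` (res-dim4-idea-3; census: drops on every
translated isolated edge at `p = 2, 3`; may recharge on origin edges at `p = 3`) and card I-11-1's
Lorentz potential (res-dim4-idea-11; exact on origin edges).  This file asserts NO census claim; it is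
the kernel form of the sentence «F4-I(p) ⟸ a secondary letter that pays on translated isolated edges
and does not recharge on the spine».

Also recorded: the single-field form (`no_isolated_branch_of_rank`) and the reading «an infinite
isolated `Step0`-branch has a translated edge beyond every time» (`exists_translated_of_isolated_branch`).

Nothing in this file is a statement about resolution of singularities; resolution in dimension ≥ 4 /
characteristic `p` is NOT proved anywhere in this programme; counted 0; AI formalisation, weaker than
expert review.  bears_on: LADDER-RESOLUTION:D157-DOOR2 (res-dim4-pi · ISO-SPINE-PO / F4-I).
Supports stmt-ResolutionOfSingularities-16155 (helper).
-/

set_option linter.dupNamespace false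

noncomputable section

open MvPolynomial Finset

namespace Summit.ResolutionOfSingularities.ResolutionOfSingularities.Theorems.PIDim4.IsoSpine

open Literature.AlgebraicGeometry.Resolution
open Literature.AlgebraicGeometry.Resolution.CentreBlowup

variable {K : Type} [Field K] [DecidableEq K]

/-- A `Step0` edge read at the chart origin (`b = 0`) is an `OriginEdge`; contrapositively, a `Step0`
edge that is NOT an `OriginEdge` was read at a translated point `b ≠ 0`. [folklore] -/
theorem originEdge_of_step0_of_eq_zero {q : ℕ} {s s' : State K} {j : Fin 4} {b : Fin 4 → K}
    (hb : b = 0) (heq : CentreBlowup.IsEquimultiplePoint q Finset.univ j b s)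
    (hs : s' = CentreBlowup.step q Finset.univ j b s) : OriginEdge q s s' := by
  subst hb
  exact ⟨j, heq, hs⟩

/-- **An infinite `Step0`-branch of isolated states has a translated edge beyond every time** (every
`q`, every field): otherwise a tail would be an all-origin isolated branch, excluded by
`no_isolated_origin_branch`. [folklore] -/
theorem exists_translated_of_isolated_branch (q : ℕ) (c : ℕ → State K)
    (hc : ∀ k, IsIsolated q (c k).F ∧ Step0 q (c k) (c (k + 1))) (N : ℕ) :
    ∃ k, N ≤ k ∧ ¬ OriginEdge q (c k) (c (k + 1)) := by
  by_contra h
  push Not at h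
  refine no_isolated_origin_branch q K ⟨fun k => c (N + k), fun k => ⟨(hc (N + k)).1, ?_, ?_⟩⟩
  · exact (hc (N + k)).2.1
  · show OriginEdge q (c (N + k)) (c (N + (k + 1)))
    rw [← Nat.add_assoc]
    exact h (N + k) (Nat.le_add_right N k)

/-- **Single-field reduction**: if `Φ : State K → ℕ` never increases along `Step0` edges between
isolated `q`-fold states and strictly decreases along the non-origin (translated) ones, then there is
no infinite `Step0`-branch of isolated states over `K`. [folklore] -/
theorem no_isolated_branch_of_rank (q : ℕ) (Φ : State K → ℕ)
    (hle : ∀ s s' : State K, IsIsolated q s.F → IsIsolated q s'.F → Step0 q s s' → Φ s' ≤ Φ s)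
    (hlt : ∀ s s' : State K, IsIsolated q s.F → IsIsolated q s'.F → Step0 q s s' →
      ¬ OriginEdge q s s' → Φ s' < Φ s) :
    ¬ ∃ c : ℕ → State K, ∀ k, IsIsolated q (c k).F ∧ Step0 q (c k) (c (k + 1)) := by
  rintro ⟨c, hc⟩
  -- `Φ ∘ c` is non-increasing, hence eventually constant
  have hmono : ∀ k, Φ (c (k + 1)) ≤ Φ (c k) := fun k =>
    hle _ _ (hc k).1 (hc (k + 1)).1 (hc k).2
  obtain ⟨T, hT⟩ := exists_eventually_const_of_succ_le (fun k => Φ (c k)) hmono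
  -- beyond `T` there is a translated edge, along which `Φ` drops strictly: contradiction
  obtain ⟨k, hk, hnot⟩ := exists_translated_of_isolated_branch q c hc T
  have hdrop := hlt _ _ (hc k).1 (hc (k + 1)).1 (hc k).2 hnot
  have h1 : Φ (c k) = Φ (c T) := hT k hk
  have h2 : Φ (c (k + 1)) = Φ (c T) := hT (k + 1) (by omega)
  omega

/-- **F4-I REDUCES TO THE TRANSLATED EDGES** (frame v4 TIER 1 (I), every `p`, `q`): if over every
field of characteristic `p` some `ℕ`-valued function on presented states never increases along
`Step0` edges between isolated `q`-fold states and strictly decreases along the translated ones, then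
`PIDim4.NoIsolatedTrap p q`.  (The spine half is part III; this is its bookkeeping consequence.  No
such `Φ` is asserted here — census candidates: I-3-2's `μ⁺`, I-11-1's Lorentz potential.) [folklore] -/
theorem noIsolatedTrap_of_rank (p q : ℕ)
    (h : ∀ (K : Type) [Field K] [CharP K p] [DecidableEq K],
      ∃ Φ : State K → ℕ,
        (∀ s s' : State K, IsIsolated q s.F → IsIsolated q s'.F → Step0 q s s' → Φ s' ≤ Φ s) ∧
        (∀ s s' : State K, IsIsolated q s.F → IsIsolated q s'.F → Step0 q s s' →
          ¬ OriginEdge q s s' → Φ s' < Φ s)) :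
    NoIsolatedTrap p q := by
  intro K _ _ _
  obtain ⟨Φ, hle, hlt⟩ := h K
  exact no_isolated_branch_of_rank q Φ hle hlt

end Summit.ResolutionOfSingularities.ResolutionOfSingularities.Theorems.PIDim4.IsoSpine

end
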